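import Mathlib.RingTheory.PowerSeries.Inverse
import Mathlib.RingTheory.MvPolynomial.Basic
import Mathlib.RingTheory.Localization.FractionRing
import Mathlib.RingTheory.Polynomial.Basic
import Mathlib.AlgebraicGeometry.Scheme
import HarnessLib

/-!
# A discrete valuation ring through every point of affine space

Topic: `Literature/AlgebraicGeometry/Resolution`. For a field `k`, a polynomial ring
`A = k[tᵢ : i ∈ σ]` and ANY prime ideal `𝔮 ⊂ A` (a point `y` of `𝔸^σ_k`, closed or not), there is
a discrete valuation ring `R` and an INJECTIVE ring homomorphism `φ : A → R` with
`φ⁻¹(𝔪_R) = 𝔮`; i.e. `Spec R → 𝔸^σ_k` sends the closed point to `y` and the generic point to the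
generic point (`exists_dvr_through`, `exists_specMap_closedPoint_eq`). This is the elementary
substitute, sufficient over affine spaces and hence over `ℙⁿ_k`, for "every Noetherian local
domain is dominated by a discrete valuation ring" used in degeneration arguments (here: de Jong
1996, 4.11–4.12, connectedness of the fibres of the pencil by specialisation from the generic
fibre, `Literature/AlgebraicGeometry/Resolution/AlterationsFibrationReduction*`).

Construction: with `L = Frac(A/𝔮)` and `α ∈ L^σ` the image of `t` (the point `y` as an
`L`-valued point), `L' = L(uᵢ : i ∈ σ)` a purely transcendental extension and `R = L'⟦ε⟧`,
set `φ(tᵢ) = αᵢ + uᵢ ε`. Then `φ(a) mod ε = a(α)`, so `φ⁻¹(ε) = 𝔮`; and `φ` is injective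
because after `ε ↦ 1` it becomes `a ↦ a(u + α)`, the base change `k[t] ↪ L[u]` followed by the
translation automorphism `u ↦ u + α` of `L[u]` (`φ` takes values in polynomials in `ε`, on
which `ε ↦ 1` makes sense). Everything is proved; no named facts.

## Sources

* [folklore] (cf. The Stacks Project, Tag 00PH for the existence of dominating valuation
  rings in general).
-/

noncomputable section

open MvPolynomial

universe u v

namespace Literature.AlgebraicGeometry.Resolution

namespace DominatingDVR

variable {k : Type u} [Field k] {σ : Type v} (𝔮 : Ideal (MvPolynomial σ k))

/-- The residue field `L = Frac(k[t]/𝔮)` of the point `𝔮`. [folklore] -/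
abbrev L : Type (max u v) := FractionRing (MvPolynomial σ k ⧸ 𝔮)

/-- The purely transcendental extension `L' = L(uᵢ : i ∈ σ)`. [folklore] -/
abbrev L' : Type (max u v) := FractionRing (MvPolynomial σ (L 𝔮))

/-- The discrete valuation ring `R = L'⟦ε⟧`. [folklore] -/
abbrev R : Type (max u v) := PowerSeries (L' 𝔮)

/-- The point `𝔮` as an `L`-valued point: `k[t] → k[t]/𝔮 → L`. [folklore] -/
def toL : MvPolynomial σ k →+* L 𝔮 :=
  (algebraMap (MvPolynomial σ k ⧸ 𝔮) (L 𝔮)).comp (Ideal.Quotient.mk 𝔮)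

/-- `L → L'` (constants of `L[u]`, then into the fraction field). [folklore] -/
def LtoL' : L 𝔮 →+* L' 𝔮 :=
  (algebraMap (MvPolynomial σ (L 𝔮)) (L' 𝔮)).comp MvPolynomial.C

/-- The point as an `L'`-valued point. [folklore] -/
def toL' : MvPolynomial σ k →+* L' 𝔮 := (LtoL' 𝔮).comp (toL 𝔮)

/-- The coordinates `αᵢ ∈ L'` of the point. [folklore] -/
def α (i : σ) : L' 𝔮 := toL' 𝔮 (X i)

/-- The transcendentals `uᵢ ∈ L'`. [folklore] -/
def u (i : σ) : L' 𝔮 := algebraMap (MvPolynomial σ (L 𝔮)) (L' 𝔮) (X i)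

/-- **The dominating homomorphism `φ : k[t] → L'⟦ε⟧`, `tᵢ ↦ αᵢ + uᵢ ε`.** [folklore] -/
def φ : MvPolynomial σ k →+* R 𝔮 :=
  eval₂Hom (PowerSeries.C.comp ((toL' 𝔮).comp MvPolynomial.C))
    fun i => PowerSeries.C (α 𝔮 i) + PowerSeries.X * PowerSeries.C (u 𝔮 i)

/-- `k[t] → L` kills exactly `𝔮`. [folklore] -/
theorem toL_injective_iff (a : MvPolynomial σ k) : toL 𝔮 a = 0 ↔ a ∈ 𝔮 := by
  rw [toL, RingHom.comp_apply, ← (algebraMap (MvPolynomial σ k ⧸ 𝔮) (L 𝔮)).map_zero,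
    (IsFractionRing.injective (MvPolynomial σ k ⧸ 𝔮) (L 𝔮)).eq_iff, Ideal.Quotient.eq_zero_iff_mem]

/-- `L → L'` is injective. [folklore] -/
theorem LtoL'_injective : Function.Injective (LtoL' 𝔮) :=
  (IsFractionRing.injective (MvPolynomial σ (L 𝔮)) (L' 𝔮)).comp (MvPolynomial.C_injective σ _)

/-- `φ(a) mod ε = a(α)`: the constant coefficient of `φ` is the point `k[t] → L'`. [folklore] -/
theorem constantCoeff_comp_φ : PowerSeries.constantCoeff.comp (φ 𝔮) = toL' 𝔮 := by
  refine MvPolynomial.ringHom_ext (fun c => ?_) (fun i => ?_)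
  · simp [φ, toL']
  · simp [φ, α]

/-- The same map with polynomial values, `k[t] → (L[u])[ε]`. [folklore] -/
def φpoly : MvPolynomial σ k →+* Polynomial (MvPolynomial σ (L 𝔮)) :=
  eval₂Hom (Polynomial.C.comp (MvPolynomial.C.comp ((toL 𝔮).comp MvPolynomial.C)))
    fun i => Polynomial.C (MvPolynomial.C (toL 𝔮 (X i))) + Polynomial.X * Polynomial.C (X i)

/-- The translation automorphism `uᵢ ↦ uᵢ + αᵢ` of `L[u]`. [folklore] -/
def translate : MvPolynomial σ (L 𝔮) ≃ₐ[L 𝔮] MvPolynomial σ (L 𝔮) :=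
  AlgEquiv.ofAlgHom (aeval fun i => X i + MvPolynomial.C (toL 𝔮 (X i)))
    (aeval fun i => X i - MvPolynomial.C (toL 𝔮 (X i)))
    (by ext i; simp)
    (by ext i; simp)

/-- After `ε ↦ 1`, `φ` is the base change `k[t] → L[u]` followed by the translation.
[folklore] -/
theorem eval_one_comp_φpoly :
    (Polynomial.evalRingHom 1).comp (φpoly 𝔮) =
      (translate 𝔮).toAlgHom.toRingHom.comp (MvPolynomial.map ((toL 𝔮).comp MvPolynomial.C)) := by
  refine MvPolynomial.ringHom_ext (fun c => ?_) (fun i => ?_)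
  · simp [φpoly, translate]
  · simp [φpoly, translate, add_comm]

/-- `φ = (polynomials ↪ power series) ∘ (L[u][ε] ↪ L'[ε]) ∘ φpoly`. [folklore] -/
theorem φ_eq_comp :
    φ 𝔮 = (Polynomial.coeToPowerSeries.ringHom.comp
      (Polynomial.mapRingHom (algebraMap (MvPolynomial σ (L 𝔮)) (L' 𝔮)))).comp (φpoly 𝔮) := by
  refine MvPolynomial.ringHom_ext (fun c => ?_) (fun i => ?_)
  · simp only [φ, φpoly, toL', LtoL', RingHom.coe_comp, Function.comp_apply, eval₂Hom_C,
      Polynomial.coe_mapRingHom, Polynomial.map_C]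
    exact (Polynomial.coe_C (R := L' 𝔮) _).symm
  · simp only [φ, φpoly, α, u, toL', LtoL', RingHom.coe_comp, Function.comp_apply, eval₂Hom_X',
      Polynomial.coe_mapRingHom, Polynomial.map_add, Polynomial.map_C, Polynomial.map_mul,
      Polynomial.map_X]
    change _ = ((Polynomial.C _ + Polynomial.X * Polynomial.C _ : Polynomial (L' 𝔮)) : PowerSeries (L' 𝔮))
    rw [Polynomial.coe_add, Polynomial.coe_mul, Polynomial.coe_C, Polynomial.coe_C, Polynomial.coe_X]

variable [𝔮.IsPrime]

/-- **`φ⁻¹(𝔪_R) = 𝔮`.** [folklore] -/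
theorem comap_maximalIdeal_φ :
    Ideal.comap (φ 𝔮) (IsLocalRing.maximalIdeal (R 𝔮)) = 𝔮 := by
  ext a
  rw [Ideal.mem_comap, IsLocalRing.mem_maximalIdeal, mem_nonunits_iff,
    PowerSeries.isUnit_iff_constantCoeff, isUnit_iff_ne_zero, not_not,
    ← RingHom.comp_apply, constantCoeff_comp_φ, toL', RingHom.comp_apply,
    ← (LtoL' 𝔮).map_zero, (LtoL'_injective 𝔮).eq_iff, toL_injective_iff]

/-- `φpoly` is injective (it becomes base change followed by translation after `ε ↦ 1`).
[folklore] -/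
theorem φpoly_injective : Function.Injective (φpoly 𝔮) := by
  have h : Function.Injective ((Polynomial.evalRingHom 1).comp (φpoly 𝔮)) := by
    rw [eval_one_comp_φpoly]
    exact (translate 𝔮).injective.comp
      (MvPolynomial.map_injective _ ((toL 𝔮).comp MvPolynomial.C).injective)
  exact Function.Injective.of_comp h

/-- **`φ` is injective.** [folklore] -/
theorem φ_injective : Function.Injective (φ 𝔮) := by
  have h1 : Function.Injective (Polynomial.coeToPowerSeries.ringHom (R := L' 𝔮)) :=
    Polynomial.coe_injective (L' 𝔮)
  have h2 : Function.Injective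
      (Polynomial.mapRingHom (algebraMap (MvPolynomial σ (L 𝔮)) (L' 𝔮))) :=
    Polynomial.map_injective _ (IsFractionRing.injective (MvPolynomial σ (L 𝔮)) (L' 𝔮))
  rw [φ_eq_comp, RingHom.coe_comp, RingHom.coe_comp]
  exact (h1.comp h2).comp (φpoly_injective 𝔮)

end DominatingDVR

/-- **A discrete valuation ring through every point of affine space.** For a field `k`, any
index type `σ` and any prime `𝔮` of `k[tᵢ : i ∈ σ]` there are a discrete valuation ring `R` and an
injective ring homomorphism `φ : k[t] → R` with `φ⁻¹(𝔪_R) = 𝔮` (namely `R = L'⟦ε⟧`,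
`φ(tᵢ) = αᵢ + uᵢ ε` as in the module docstring). [folklore] -/
theorem exists_dvr_through {k : Type u} [Field k] {σ : Type v} (𝔮 : Ideal (MvPolynomial σ k))
    [𝔮.IsPrime] :
    ∃ (R : Type (max u v)) (_ : CommRing R) (_ : IsDomain R) (_ : IsDiscreteValuationRing R)
      (φ : MvPolynomial σ k →+* R),
      Function.Injective φ ∧ Ideal.comap φ (IsLocalRing.maximalIdeal R) = 𝔮 :=
  ⟨DominatingDVR.R 𝔮, inferInstance, inferInstance, inferInstance, DominatingDVR.φ 𝔮,
    DominatingDVR.φ_injective 𝔮, DominatingDVR.comap_maximalIdeal_φ 𝔮⟩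

open _root_.AlgebraicGeometry CategoryTheory

/-- **Scheme form**: for every point `y` of `𝔸^σ_k = Spec k[t]` there are a discrete valuation
ring `R` and a dominant morphism `Spec R → 𝔸^σ_k` (induced by an injective `k[t] → R`) sending
the closed point to `y`. [folklore] -/
theorem exists_specMap_closedPoint_eq {k : Type u} [Field k] {σ : Type u}
    (y : Spec (CommRingCat.of (MvPolynomial σ k))) :
    ∃ (R : Type u) (_ : CommRing R) (_ : IsDomain R) (_ : IsDiscreteValuationRing R)
      (φ : MvPolynomial σ k →+* R),
      Function.Injective φ ∧
        (Spec.map (CommRingCat.ofHom φ)) (IsLocalRing.closedPoint R) = y := by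
  haveI : y.asIdeal.IsPrime := y.2
  obtain ⟨R, _, _, _, φ, hφ, hcomap⟩ := exists_dvr_through (σ := σ) y.asIdeal
  refine ⟨R, inferInstance, inferInstance, inferInstance, φ, hφ, ?_⟩
  apply PrimeSpectrum.ext
  exact hcomap

end Literature.AlgebraicGeometry.Resolution

end
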